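import Summits.AnomalousDissipation.AnomalousDissipation.Theorems.DegreeGateFrontHeadRungsShell


/-!
# DegreeGate — the front readout HEADS (BC5 rungs of `route-AnomalousDissipation-DegreeGate`, now theorems)

decomp-ad lens-5 g65 (intended tree path
`Summits/AnomalousDissipation/AnomalousDissipation/Theorems/DegreeGateFrontHeadRungs.lean`).

The two open cruxes of the route, `FrontSlimAllTG` (stmt-AnomalousDissipation-28049) and `FrontLoudAllTG`
(stmt-AnomalousDissipation-28050), were born with PLAN-ONLY heads on a finite viscosity range
(`Birth.stub_frontSlim_head` on `[1/300, 1/100]`, `Birth.stub_frontLoud_head` on `[1/2000, 1/100]`). This file proves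
both heads for EVERY Taylor–Green-symmetric steady weak solution with the energy equation (no connectedness, no
selection), from the Fourier support of the symmetry class:

* §1 the symmetries on the Fourier side: the two half-shifts kill every `k` unless `k₀ ≡ k₁ ≡ k₂ (mod 2)`
  (`fc_eq_zero_of_halfShift`), the coordinate mirrors give `Û(R_i k)_j = ∓Û(k)_j` (`fc_update_neg_apply`), the
  quarter turn `x ↦ (½ − x₁, x₀, x₂)` relates `Û(−k₁, k₀, k₂)` to `Û(k)` (`fc_quarterTurn`), reality and mean zero;
* §2 the integer trichotomy (`tgShell_or_eight_le_or_axis`): a frequency with `k₀ ≡ k₁ ≡ k₂ (mod 2)` is on the shell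
  `{±1}³`, or has `|k|² ≥ 8`, or has at most one non-zero coordinate; and `|k|² ≥ 3` if `k ≠ 0` (`three_le_of_parity`);
* §3 the Fourier support of the class (`fc_eq_zero_or`, `fc_eq_zero_or_three_le`: axis frequencies are killed by
  mirrors + incompressibility) and ONE bookkeeping lemma `spectral_gap_bookkeeping`
  (`4π² m ∫|U|² ≤ ‖∇U‖² + 4π² b Σ_{k ∈ S} |Û(k)|²` whenever every charged frequency has `|k|² ≥ m`, up to a defect `b`
  on the finite set `S`), giving `12π² ∫|U|² ≤ ‖∇U‖²` (half-shifts + mean zero) and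
  `32π² ∫|U|² ≤ ‖∇U‖² + 20π² S₃`, `S₃ = Σ_{shell} |Û(k)|²` (full class);
* §4 the shell identity `S₃ = 4 (U, f_TG)²` (`shell_energy_eq`: with the mirrors and the quarter turn the shell part
  of `U` is `4 (U, f_TG) f_TG`);
* §5 the heads with minimal hypotheses: `frontSlimHead` — `∫|u|² < 2` on `[1/300, 1/100]` (indeed `≤ 1/(576π⁴ν²)`;
  uses only `V`-membership, the energy equation and the two half-shifts) and `frontLoudHead` — `(u, f_TG) ≥ 1/200` on
  `[1/2000, 1/100]` (weak form tested with `f_TG`: `1/4 = 12π²ν(u,f) − ∫(u·∇)f·u`, `|∫(u·∇)f·u| ≤ 2π∫|u|²`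
  (`Theorems.DegreeGate.abs_inertialPairing_tgForce_le`, p824959), and `32π²ν∫|u|² ≤ (u,f) + 80π²ν(u,f)²`);
* §6 the heads in the cruxes' OWN currency (`frontSlimAllTG_head` / `frontLoudAllTG_head` = the crux texts verbatim
  with `0 < ν` replaced by `1/300 ≤ ν` / `1/2000 ≤ ν`) and in the kernel's unfolded currency
  (`frontSlimHeadTG_holds` / `frontLoudHeadTG_holds` = the birth file's `FrontSlimHeadTG` / `FrontLoudHeadTG`).

What remains OPEN of each crux is exactly its vanishing-viscosity TAIL (`0 < ν < 1/300`, resp. `0 < ν < 1/2000`).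

References: Temam 1979 Ch. II §1 (steady weak solutions, energy equation) [Temam1979]; Brachet et al.,
J. Fluid Mech. 130 (1983) 411–452, §2 (the symmetries of the Taylor–Green vortex act on Fourier modes)
[doi:10.1017/s0022112083001159]; FMRT 2001 Ch. II (Stokes operator on the torus, Poincaré) [FMRTTurbulence2001].

TREE LANDING NOTE (decomp-ad census g17, prover-role seat): the lens-5 g65 landable (sha256 f2ac4b88dd473364…, 824 l.) was BOUNCED
by the gate lint `statement-form` (Theorems files with proofs ≤ 400 lines) and is landed SPLIT BY TOPIC into three modules with every
declaration byte-identical: `DegreeGateFrontHeadRungsFourier` (§1 Fourier coefficients of an `L²` class and the Taylor–Green symmetries,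
§2 parity bookkeeping on `ℤ³`), `DegreeGateFrontHeadRungsShell` (§3 Fourier support and the two Poincaré constants, §4 the forcing shell;
imports the first) and this file (§5 the two finite-range head rungs, §6 the heads in the route's own currency; imports the second).
The local notation `𝐋` is re-declared in each part.
-/

noncomputable section

set_option linter.dupNamespace false
set_option linter.style.longLine false

open MeasureTheory Filter UnitAddTorus
open scoped InnerProductSpace ComplexConjugate ENNReal
open Literature.Analysis Literature.Analysis.FunctionSpaces Literature.Analysis.FunctionSpaces.Torus
open Summit.AnomalousDissipation.AnomalousDissipation.Theorems.TaylorGreenLoudGalerkinStates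
open Summit.AnomalousDissipation.AnomalousDissipation.Theorems.TaylorGreenLoudGalerkinStates.Negative

namespace Summit.AnomalousDissipation.AnomalousDissipation.Theorems.DegreeGate

/-- The `L²(T³; ℝ³)` classes (local shorthand, not a definition). -/
local notation "𝐋" => MeasureTheory.Lp (EuclideanSpace ℝ (Fin 3)) 2 (MeasureTheory.volume : MeasureTheory.Measure (UnitAddTorus (Fin 3)))

/-! ### §5 The two finite-range head rungs -/

/-- Real arithmetic of the loud head: the two inequalities `¼ ≤ 12π²νD + 2πE` (steady equation tested with
`f_TG`) and `32π²νE ≤ D + 80π²νD²` (`λ = 32π²` off the shell, shell part `4D²`, energy equation) are incompatible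
with `0 ≤ D < 1/200` for `ν ∈ [1/2000, 1/100]`. [folklore] -/
theorem loudHead_arith {D E ν : ℝ} (hπl : 3.14 < Real.pi) (hπu : Real.pi < 3.15)
    (hν : 1/2000 ≤ ν) (hν₁ : ν ≤ 1/100) (hD0 : 0 ≤ D) (hD : D < 1/200) (hE0 : 0 ≤ E)
    (h1 : 1/4 ≤ 12 * Real.pi ^ 2 * ν * D + 2 * Real.pi * E)
    (h2 : 32 * Real.pi ^ 2 * ν * E ≤ D + 80 * Real.pi ^ 2 * ν * D ^ 2) : False := by
  have hπ0 := Real.pi_pos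
  have hπ2u : Real.pi ^ 2 ≤ 9.9225 := by nlinarith
  have hπ2l : 9.8596 ≤ Real.pi ^ 2 := by nlinarith
  have hA1 : Real.pi ^ 2 * ν ≤ 9.9225 * (1/100) := mul_le_mul hπ2u hν₁ (by linarith) (by norm_num)
  have hD2 : D ^ 2 ≤ D * (1/200) := by
    rw [sq]
    exact mul_le_mul_of_nonneg_left hD.le hD0
  have hA : Real.pi ^ 2 * ν * D ^ 2 ≤ 9.9225 * (1/100) * (D * (1/200)) := mul_le_mul hA1 hD2 (sq_nonneg D) (by norm_num)
  have hC1 : 9.8596 * (1/2000) ≤ Real.pi ^ 2 * ν := mul_le_mul hπ2l hν (by norm_num) (by positivity)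
  have hC : 9.8596 * (1/2000) * E ≤ Real.pi ^ 2 * ν * E := mul_le_mul_of_nonneg_right hC1 hE0
  have hD1 : Real.pi ^ 2 * ν * D ≤ 9.9225 * (1/100) * D := mul_le_mul_of_nonneg_right hA1 hD0
  have hE1 : Real.pi * E ≤ 3.15 * E := mul_le_mul_of_nonneg_right hπu.le hE0
  linarith

/-- Real arithmetic of the slim head: `12π²ν n² ≤ D ≤ n/2` with `ν ≥ 1/300` forces `n² < 2`. [folklore] -/
theorem slimHead_arith {D n ν : ℝ} (hπ : 3 < Real.pi) (hν : 1/300 ≤ ν) (hn : 0 ≤ n) (hD : D ≤ n * 2⁻¹)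
    (h : 12 * Real.pi ^ 2 * ν * n ^ 2 ≤ D) : n ^ 2 < 2 := by
  by_contra! h2
  have hn1 : 1 ≤ n := by nlinarith
  have hπ2 : 9 ≤ Real.pi ^ 2 := by nlinarith
  have hA : 9 * (1/300) ≤ Real.pi ^ 2 * ν := mul_le_mul hπ2 hν (by norm_num) (by positivity)
  have hB : 9 * (1/300) * n ≤ Real.pi ^ 2 * ν * n := mul_le_mul_of_nonneg_right hA hn
  have hmain : 12 * Real.pi ^ 2 * ν * n ≤ 2⁻¹ :=
    le_of_mul_le_mul_right (by linarith [h.trans hD] : 12 * Real.pi ^ 2 * ν * n * n ≤ 2⁻¹ * n) (by linarith)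
  have hn2 : n ≤ 25/18 := by linarith
  have hn3 : n ^ 2 ≤ (25/18) ^ 2 := pow_le_pow_left₀ hn hn2 2
  norm_num at hn3
  linarith

/-- **Slim head (minimal hypotheses).** For `ν ≥ 1/300`, every `u ∈ V` with the energy equation
`ν‖∇u‖² = (u, f_TG)` whose class is invariant under the two half-period shifts has `∫|u|² < 2`: the shifts and
mean zero give `λ₁ = 12π²`, so `12π²ν ∫|u|² ≤ ν‖∇u‖² = (u, f_TG) ≤ ½ (∫|u|²)^{1/2}`, i.e.
`∫|u|² ≤ 1/(576π⁴ν²) < 2`. Neither the steady equation nor the mirrors / quarter turn are used. [folklore] -/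
theorem frontSlimHead {ν : ℝ} (hν : (1/300 : ℝ) ≤ ν) (u : ↥(energySpace (Fin 3)))
    (hV : (u : 𝐋) ∈ energySpaceV (Fin 3))
    (hEq : ν * (eGradNormSq ((u : 𝐋) : UnitAddTorus (Fin 3) → EuclideanSpace ℝ (Fin 3))).toReal =
      Literature.Analysis.FluidPDE.Torus.pairing (u : 𝐋) tgForce)
    (hS1 : (fun x => ((u : 𝐋) : UnitAddTorus (Fin 3) → EuclideanSpace ℝ (Fin 3)) (x + (Pi.single (0 : Fin 3) (((1/2 : ℝ)) : UnitAddCircle) + Pi.single (1 : Fin 3) (((1/2 : ℝ)) : UnitAddCircle)))) =ᵐ[volume] ((u : 𝐋) : UnitAddTorus (Fin 3) → EuclideanSpace ℝ (Fin 3)))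
    (hS2 : (fun x => ((u : 𝐋) : UnitAddTorus (Fin 3) → EuclideanSpace ℝ (Fin 3)) (x + (Pi.single (0 : Fin 3) (((1/2 : ℝ)) : UnitAddCircle) + Pi.single (2 : Fin 3) (((1/2 : ℝ)) : UnitAddCircle)))) =ᵐ[volume] ((u : 𝐋) : UnitAddTorus (Fin 3) → EuclideanSpace ℝ (Fin 3))) :
    (∫ x, ‖(u : 𝐋) x‖ ^ 2) < 2 := by
  have hU : (u : 𝐋) ∈ energySpace (Fin 3) := u.2
  have hν0 : 0 < ν := lt_of_lt_of_le (by norm_num) hν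
  have hfin : eGradNormSq ((u : 𝐋) : UnitAddTorus (Fin 3) → EuclideanSpace ℝ (Fin 3)) ≠ ⊤ :=
    (MemSobolev.eGradNormSq_lt_top hV.2).ne
  -- λ₁ = 12π² on the class
  have hP := spectral_gap_bookkeeping (u : 𝐋) hfin (m := 3) (b := 0) (by norm_num) le_rfl ∅ fun k => by
    rcases fc_eq_zero_or_three_le hU hS1 hS2 k with h | h
    · exact Or.inl h
    · exact Or.inr (Or.inr (by rw [freqNormSq_fin3]; exact_mod_cast h))
  simp only [Finset.sum_empty, mul_zero, add_zero] at hP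
  -- (u, f_TG) ≤ ‖u‖ ‖f_TG‖ = ‖u‖ / 2
  have hD := (abs_le.1 (Literature.Analysis.FluidPDE.Torus.abs_pairing_coe_le (isSmooth_tgForce.memLp 2) u)).2
  rw [Literature.Analysis.FluidPDE.Torus.norm_toLp_eq_sqrt, integral_norm_sq_tgForce, Real.sqrt_inv,
    show (4 : ℝ) = 2 ^ 2 by norm_num, Real.sqrt_sq (by norm_num : (0 : ℝ) ≤ 2), Submodule.coe_norm] at hD
  rw [Literature.Analysis.FluidPDE.Torus.integral_norm_sq_coe_eq] at hP ⊢
  refine slimHead_arith Real.pi_gt_three hν (norm_nonneg _) hD ?_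
  have := mul_le_mul_of_nonneg_left hP hν0.le
  linarith

/-- **Loud head (minimal hypotheses).** For `1/2000 ≤ ν ≤ 1/100`, every Taylor–Green–symmetric steady weak
solution `u ∈ V` of NS_ν(f_TG) with the energy equation has `(u, f_TG) ≥ 1/200`: the steady equation tested with
`f_TG` gives `¼ ≤ 12π²ν(u,f_TG) + 2π∫|u|²`, while `λ = 32π²` off the forcing shell and the shell identity
`Σ_{shell} ‖û(k)‖² = 4(u,f_TG)²` give `32π²ν∫|u|² ≤ (u,f_TG) + 80π²ν(u,f_TG)²`; the two are incompatible with
`(u, f_TG) < 1/200` on this range (`loudHead_arith`). [folklore] -/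
theorem frontLoudHead {ν : ℝ} (hν : (1/2000 : ℝ) ≤ ν) (hν₁ : ν ≤ 1/100) (u : ↥(energySpace (Fin 3)))
    (hV : (u : 𝐋) ∈ energySpaceV (Fin 3))
    (hsol : Literature.Analysis.FluidPDE.Torus.IsSteadyWeakSolution ν tgForce u)
    (hEq : ν * (eGradNormSq ((u : 𝐋) : UnitAddTorus (Fin 3) → EuclideanSpace ℝ (Fin 3))).toReal =
      Literature.Analysis.FluidPDE.Torus.pairing (u : 𝐋) tgForce)
    (hM : ∀ i j : Fin 3, (fun x => ((u : 𝐋) : UnitAddTorus (Fin 3) → EuclideanSpace ℝ (Fin 3)) (Function.update x i (-x i)) j) =ᵐ[volume]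
      (fun x => if j = i then -(((u : 𝐋) : UnitAddTorus (Fin 3) → EuclideanSpace ℝ (Fin 3)) x j) else ((u : 𝐋) : UnitAddTorus (Fin 3) → EuclideanSpace ℝ (Fin 3)) x j))
    (hS1 : (fun x => ((u : 𝐋) : UnitAddTorus (Fin 3) → EuclideanSpace ℝ (Fin 3)) (x + (Pi.single (0 : Fin 3) (((1/2 : ℝ)) : UnitAddCircle) + Pi.single (1 : Fin 3) (((1/2 : ℝ)) : UnitAddCircle)))) =ᵐ[volume] ((u : 𝐋) : UnitAddTorus (Fin 3) → EuclideanSpace ℝ (Fin 3)))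
    (hS2 : (fun x => ((u : 𝐋) : UnitAddTorus (Fin 3) → EuclideanSpace ℝ (Fin 3)) (x + (Pi.single (0 : Fin 3) (((1/2 : ℝ)) : UnitAddCircle) + Pi.single (2 : Fin 3) (((1/2 : ℝ)) : UnitAddCircle)))) =ᵐ[volume] ((u : 𝐋) : UnitAddTorus (Fin 3) → EuclideanSpace ℝ (Fin 3)))
    (hQ : (fun x => ((u : 𝐋) : UnitAddTorus (Fin 3) → EuclideanSpace ℝ (Fin 3)) ![(((1/2 : ℝ)) : UnitAddCircle) - x 1, x 0, x 2]) =ᵐ[volume]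
      (fun x => !₂[-(((u : 𝐋) : UnitAddTorus (Fin 3) → EuclideanSpace ℝ (Fin 3)) x 1), ((u : 𝐋) : UnitAddTorus (Fin 3) → EuclideanSpace ℝ (Fin 3)) x 0, ((u : 𝐋) : UnitAddTorus (Fin 3) → EuclideanSpace ℝ (Fin 3)) x 2])) :
    (1/200 : ℝ) ≤ Literature.Analysis.FluidPDE.Torus.pairing (u : 𝐋) tgForce := by
  have hU : (u : 𝐋) ∈ energySpace (Fin 3) := u.2
  have hν0 : 0 < ν := lt_of_lt_of_le (by norm_num) hν
  have hfin : eGradNormSq ((u : 𝐋) : UnitAddTorus (Fin 3) → EuclideanSpace ℝ (Fin 3)) ≠ ⊤ :=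
    (MemSobolev.eGradNormSq_lt_top hV.2).ne
  by_contra hlt
  have hDlt : Literature.Analysis.FluidPDE.Torus.pairing (u : 𝐋) tgForce < 1/200 := not_le.1 hlt
  have hD0 : 0 ≤ Literature.Analysis.FluidPDE.Torus.pairing (u : 𝐋) tgForce := by
    rw [← hEq]; exact mul_nonneg hν0.le ENNReal.toReal_nonneg
  have hE0 : 0 ≤ ∫ x, ‖(u : 𝐋) x‖ ^ 2 := integral_nonneg fun _ => by positivity
  -- the steady equation tested with the force itself
  have h0 := hsol tgForce isSmooth_tgForce isDivFree_tgForce hasZeroMean_tgForce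
  have hff : ∫ x, ⟪tgForce x, tgForce x⟫_ℝ = 4⁻¹ := by
    simp_rw [real_inner_self_eq_norm_sq]; exact integral_norm_sq_tgForce
  have hlap : ∫ x, ⟪((u : 𝐋) : UnitAddTorus (Fin 3) → EuclideanSpace ℝ (Fin 3)) x, Torus.laplacian tgForce x⟫_ℝ =
      -(12 * Real.pi ^ 2) * Literature.Analysis.FluidPDE.Torus.pairing (u : 𝐋) tgForce := by
    simp_rw [Summit.AnomalousDissipation.AnomalousDissipation.Theorems.PumpedMirrorMirrorFloorTG.laplacian_tgForce_apply,
      real_inner_smul_right]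
    rw [integral_const_mul]
    rfl
  simp only [Literature.Analysis.FluidPDE.Torus.nsGeneratorPairing, hff, hlap] at h0
  have hI := abs_le.1 (abs_inertialPairing_tgForce_le (u : 𝐋))
  have hIeq : Literature.Analysis.FluidPDE.Torus.inertialPairing (u : 𝐋) tgForce =
      -(4⁻¹) + 12 * (Real.pi ^ 2 * (ν * Literature.Analysis.FluidPDE.Torus.pairing (u : 𝐋) tgForce)) := by
    linear_combination h0
  have h1 : 1/4 ≤ 12 * Real.pi ^ 2 * ν * Literature.Analysis.FluidPDE.Torus.pairing (u : 𝐋) tgForce +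
      2 * Real.pi * ∫ x, ‖(u : 𝐋) x‖ ^ 2 := by
    linarith [hI.1, hIeq]
  -- λ = 32π² off the forcing shell, and the shell part 4(u,f_TG)²
  have hspec := spectral_gap_bookkeeping (u : 𝐋) hfin (m := 8) (b := 5) (by norm_num) (by norm_num) tgShell fun k => by
    rcases fc_eq_zero_or hU hM hS1 hS2 k with h | h | h
    · exact Or.inl h
    · exact Or.inr (Or.inl ⟨h, by
        rw [Summit.AnomalousDissipation.AnomalousDissipation.Theorems.TaylorGreenLogLoudStates.Negative.freqNormSq_of_mem_tgShell h]
        norm_num⟩)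
    · exact Or.inr (Or.inr (by rw [freqNormSq_fin3]; exact_mod_cast h))
  rw [shell_energy_eq (u : 𝐋) hM hQ] at hspec
  have h2 : 32 * Real.pi ^ 2 * ν * (∫ x, ‖(u : 𝐋) x‖ ^ 2) ≤ Literature.Analysis.FluidPDE.Torus.pairing (u : 𝐋) tgForce +
      80 * Real.pi ^ 2 * ν * (Literature.Analysis.FluidPDE.Torus.pairing (u : 𝐋) tgForce) ^ 2 := by
    have := mul_le_mul_of_nonneg_left hspec hν0.le
    linarith [this, hEq]
  exact loudHead_arith Real.pi_gt_d2 Real.pi_lt_d2 hν hν₁ hD0 hDlt hE0 h1 h2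

/-! ### §6 The heads in the route's own currency

The two head rungs in the VERBATIM currency of the cruxes `FrontSlimAllTG` (stmt-AnomalousDissipation-28049) and
`FrontLoudAllTG` (stmt-AnomalousDissipation-28050) of `route-AnomalousDissipation-DegreeGate`: the same force binder,
top slice `ν₀ = 1/5`, wall-free slab steady set and connected component, with the viscosity range `0 < ν ≤ 1/100`
replaced by the finite HEAD ranges `1/300 ≤ ν ≤ 1/100` (slim; witness `E₁ = 2`) and `1/2000 ≤ ν ≤ 1/100` (loud).
Neither the component nor the top-slice state is used: on these ranges EVERY Taylor–Green–symmetric front is slim,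
resp. loud (`frontSlimHead`, `frontLoudHead`); the tree constant `tgForce` is definitionally the route's lambda. What
remains of each crux is its TAIL `0 < ν < 1/300` resp. `0 < ν < 1/2000` — the vanishing-viscosity residual. -/

/-- **Slim head in crux currency**: `FrontSlimAllTG` (stmt-AnomalousDissipation-28049) VERBATIM with `0 < ν` replaced
by `1/300 ≤ ν` — every front of the wall-free primary continuum at a level `ν ∈ [1/300, 1/100]` has `∫|u|² < 2`
(indeed `≤ 1/(576π⁴ν²)`; `λ₁ = 12π²` on the Taylor–Green class). [folklore] -/
theorem frontSlimAllTG_head :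
    ∀ f : UnitAddTorus (Fin 3) → EuclideanSpace ℝ (Fin 3), f = (fun x => !₂[(fourier 1 (x 0) : ℂ).im * (fourier 1 (x 1) : ℂ).re * (fourier 1 (x 2) : ℂ).re, -((fourier 1 (x 0) : ℂ).re * (fourier 1 (x 1) : ℂ).im * (fourier 1 (x 2) : ℂ).re), (0 : ℝ)]) → ∃ E₁ : ℝ, 1 ≤ E₁ ∧ ∀ ν : ℝ, (1/300 : ℝ) ≤ ν → ν ≤ 1/100 → ∀ u_top : ↥(Literature.Analysis.FunctionSpaces.Torus.energySpace (Fin 3)), ((u_top : MeasureTheory.Lp (EuclideanSpace ℝ (Fin 3)) 2 (MeasureTheory.volume (α := UnitAddTorus (Fin 3)))) ∈ Literature.Analysis.FunctionSpaces.Torus.energySpaceV (Fin 3) ∧ Literature.Analysis.FluidPDE.Torus.IsSteadyWeakSolution (1/5 : ℝ) f u_top ∧ (1/5 : ℝ) * (Literature.Analysis.FunctionSpaces.Torus.eGradNormSq (⇑(u_top : MeasureTheory.Lp (EuclideanSpace ℝ (Fin 3)) 2 (MeasureTheory.volume (α := UnitAddTorus (Fin 3)))))).toReal = Literature.Analysis.FluidPDE.Torus.pairing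 (u_top : MeasureTheory.Lp (EuclideanSpace ℝ (Fin 3)) 2 (MeasureTheory.volume (α := UnitAddTorus (Fin 3)))) f ∧ ((∀ i j : Fin 3, (fun x => (⇑(u_top : MeasureTheory.Lp (EuclideanSpace ℝ (Fin 3)) 2 (MeasureTheory.volume (α := UnitAddTorus (Fin 3))))) (Function.update x i (-x i)) j) =ᵐ[MeasureTheory.volume] (fun x => if j = i then -((⇑(u_top : MeasureTheory.Lp (EuclideanSpace ℝ (Fin 3)) 2 (MeasureTheory.volume (α := UnitAddTorus (Fin 3))))) x j) else (⇑(u_top : MeasureTheory.Lp (EuclideanSpace ℝ (Fin 3)) 2 (MeasureTheory.volume (α := UnitAddTorus (Fin 3))))) x j)) ∧ ((fun x => (⇑(u_top : MeasureTheory.Lp (EuclideanSpace ℝ (Fin 3)) 2 (MeasureTheory.volume (α := UnitAddTorus (Fin 3))))) (x + (Pi.single (0 : Fin 3) (((1/2 : ℝ)) : UnitAddCircle) + Pi.single (1 : Fin 3) (((1/2 : ℝ)) : UnitAddCircle)))) =ᵐ[MeasureTheory.volume] (⇑(u_top : MeasureTheory.Lp (EuclideanSpace ℝ (Fin 3)) 2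 (MeasureTheory.volume (α := UnitAddTorus (Fin 3)))))) ∧ ((fun x => (⇑(u_top : MeasureTheory.Lp (EuclideanSpace ℝ (Fin 3)) 2 (MeasureTheory.volume (α := UnitAddTorus (Fin 3))))) (x + (Pi.single (0 : Fin 3) (((1/2 : ℝ)) : UnitAddCircle) + Pi.single (2 : Fin 3) (((1/2 : ℝ)) : UnitAddCircle)))) =ᵐ[MeasureTheory.volume] (⇑(u_top : MeasureTheory.Lp (EuclideanSpace ℝ (Fin 3)) 2 (MeasureTheory.volume (α := UnitAddTorus (Fin 3)))))) ∧ ((fun x => (⇑(u_top : MeasureTheory.Lp (EuclideanSpace ℝ (Fin 3)) 2 (MeasureTheory.volume (α := UnitAddTorus (Fin 3))))) ![(((1/2 : ℝ)) : UnitAddCircle) - x 1, x 0, x 2]) =ᵐ[MeasureTheory.volume] (fun x => !₂[-((⇑(u_top : MeasureTheory.Lp (EuclideanSpace ℝ (Fin 3)) 2 (MeasureTheory.volume (α := UnitAddTorus (Fin 3))))) x 1), (⇑(u_top : MeasureTheory.Lp (EuclideanSpace ℝ (Fin 3)) 2 (MeasureTheory.volume (α := UnitAddTorus (Fin 3)))))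 x 0, (⇑(u_top : MeasureTheory.Lp (EuclideanSpace ℝ (Fin 3)) 2 (MeasureTheory.volume (α := UnitAddTorus (Fin 3))))) x 2])))) → ∀ p ∈ connectedComponentIn {q : ℝ × ↥(Literature.Analysis.FunctionSpaces.Torus.energySpace (Fin 3)) | ν ≤ q.1 ∧ q.1 ≤ (1/5 : ℝ) ∧ ((q.2 : MeasureTheory.Lp (EuclideanSpace ℝ (Fin 3)) 2 (MeasureTheory.volume (α := UnitAddTorus (Fin 3)))) ∈ Literature.Analysis.FunctionSpaces.Torus.energySpaceV (Fin 3) ∧ Literature.Analysis.FluidPDE.Torus.IsSteadyWeakSolution q.1 f q.2 ∧ q.1 * (Literature.Analysis.FunctionSpaces.Torus.eGradNormSq (⇑(q.2 : MeasureTheory.Lp (EuclideanSpace ℝ (Fin 3)) 2 (MeasureTheory.volume (α := UnitAddTorus (Fin 3)))))).toReal = Literature.Analysis.FluidPDE.Torus.pairing (q.2 : MeasureTheory.Lp (EuclideanSpace ℝ (Fin 3)) 2 (MeasureTheory.volume (α := UnitAddTorus (Fin 3)))) f ∧ ((∀ i j : Fin 3, (fun x => (⇑(q.2 : MeasureTheory.Lp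 (EuclideanSpace ℝ (Fin 3)) 2 (MeasureTheory.volume (α := UnitAddTorus (Fin 3))))) (Function.update x i (-x i)) j) =ᵐ[MeasureTheory.volume] (fun x => if j = i then -((⇑(q.2 : MeasureTheory.Lp (EuclideanSpace ℝ (Fin 3)) 2 (MeasureTheory.volume (α := UnitAddTorus (Fin 3))))) x j) else (⇑(q.2 : MeasureTheory.Lp (EuclideanSpace ℝ (Fin 3)) 2 (MeasureTheory.volume (α := UnitAddTorus (Fin 3))))) x j)) ∧ ((fun x => (⇑(q.2 : MeasureTheory.Lp (EuclideanSpace ℝ (Fin 3)) 2 (MeasureTheory.volume (α := UnitAddTorus (Fin 3))))) (x + (Pi.single (0 : Fin 3) (((1/2 : ℝ)) : UnitAddCircle) + Pi.single (1 : Fin 3) (((1/2 : ℝ)) : UnitAddCircle)))) =ᵐ[MeasureTheory.volume] (⇑(q.2 : MeasureTheory.Lp (EuclideanSpace ℝ (Fin 3)) 2 (MeasureTheory.volume (α := UnitAddTorus (Fin 3)))))) ∧ ((fun x => (⇑(q.2 : MeasureTheory.Lp (EuclideanSpace ℝ (Fin 3)) 2 (MeasureTheory.volume (α := UnitAddTorus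 (Fin 3))))) (x + (Pi.single (0 : Fin 3) (((1/2 : ℝ)) : UnitAddCircle) + Pi.single (2 : Fin 3) (((1/2 : ℝ)) : UnitAddCircle)))) =ᵐ[MeasureTheory.volume] (⇑(q.2 : MeasureTheory.Lp (EuclideanSpace ℝ (Fin 3)) 2 (MeasureTheory.volume (α := UnitAddTorus (Fin 3)))))) ∧ ((fun x => (⇑(q.2 : MeasureTheory.Lp (EuclideanSpace ℝ (Fin 3)) 2 (MeasureTheory.volume (α := UnitAddTorus (Fin 3))))) ![(((1/2 : ℝ)) : UnitAddCircle) - x 1, x 0, x 2]) =ᵐ[MeasureTheory.volume] (fun x => !₂[-((⇑(q.2 : MeasureTheory.Lp (EuclideanSpace ℝ (Fin 3)) 2 (MeasureTheory.volume (α := UnitAddTorus (Fin 3))))) x 1), (⇑(q.2 : MeasureTheory.Lp (EuclideanSpace ℝ (Fin 3)) 2 (MeasureTheory.volume (α := UnitAddTorus (Fin 3))))) x 0, (⇑(q.2 : MeasureTheory.Lp (EuclideanSpace ℝ (Fin 3)) 2 (MeasureTheory.volume (α := UnitAddTorus (Fin 3))))) x 2]))))} ((1/5 : ℝ), u_top),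 p.1 = ν → (∫ x, ‖(p.2 : MeasureTheory.Lp (EuclideanSpace ℝ (Fin 3)) 2 (MeasureTheory.volume (α := UnitAddTorus (Fin 3)))) x‖ ^ 2) < E₁ := by
  intro f hf
  subst hf
  refine ⟨2, by norm_num, ?_⟩
  intro ν hν _ u_top _ p hp hpν
  have hmem := connectedComponentIn_subset _ _ hp
  simp only [Set.mem_setOf_eq] at hmem
  obtain ⟨_, _, hV, _, hen, _, hS1, hS2, _⟩ := hmem
  rw [hpν] at hen
  exact frontSlimHead hν p.2 hV hen hS1 hS2

/-- **Loud head in crux currency**: `FrontLoudAllTG` (stmt-AnomalousDissipation-28050) VERBATIM with `0 < ν` replaced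
by `1/2000 ≤ ν` — every front of the wall-free primary continuum at a level `ν ∈ [1/2000, 1/100]` has
`(u, f_TG) ≥ 1/200` (`λ = 32π²` off the forcing shell + the shell identity + the steady equation tested with `f_TG`).
[folklore] -/
theorem frontLoudAllTG_head :
    ∀ f : UnitAddTorus (Fin 3) → EuclideanSpace ℝ (Fin 3), f = (fun x => !₂[(fourier 1 (x 0) : ℂ).im * (fourier 1 (x 1) : ℂ).re * (fourier 1 (x 2) : ℂ).re, -((fourier 1 (x 0) : ℂ).re * (fourier 1 (x 1) : ℂ).im * (fourier 1 (x 2) : ℂ).re), (0 : ℝ)]) → ∀ ν : ℝ, (1/2000 : ℝ) ≤ ν → ν ≤ 1/100 → ∀ u_top : ↥(Literature.Analysis.FunctionSpaces.Torus.energySpace (Fin 3)), ((u_top : MeasureTheory.Lp (EuclideanSpace ℝ (Fin 3)) 2 (MeasureTheory.volume (α := UnitAddTorus (Fin 3)))) ∈ Literature.Analysis.FunctionSpaces.Torus.energySpaceV (Fin 3) ∧ Literature.Analysis.FluidPDE.Torus.IsSteadyWeakSolution (1/5 : ℝ) f u_top ∧ (1/5 : ℝ) * (Literature.Analysis.FunctionSpaces.Torus.eGradNormSq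 (⇑(u_top : MeasureTheory.Lp (EuclideanSpace ℝ (Fin 3)) 2 (MeasureTheory.volume (α := UnitAddTorus (Fin 3)))))).toReal = Literature.Analysis.FluidPDE.Torus.pairing (u_top : MeasureTheory.Lp (EuclideanSpace ℝ (Fin 3)) 2 (MeasureTheory.volume (α := UnitAddTorus (Fin 3)))) f ∧ ((∀ i j : Fin 3, (fun x => (⇑(u_top : MeasureTheory.Lp (EuclideanSpace ℝ (Fin 3)) 2 (MeasureTheory.volume (α := UnitAddTorus (Fin 3))))) (Function.update x i (-x i)) j) =ᵐ[MeasureTheory.volume] (fun x => if j = i then -((⇑(u_top : MeasureTheory.Lp (EuclideanSpace ℝ (Fin 3)) 2 (MeasureTheory.volume (α := UnitAddTorus (Fin 3))))) x j) else (⇑(u_top : MeasureTheory.Lp (EuclideanSpace ℝ (Fin 3)) 2 (MeasureTheory.volume (α := UnitAddTorus (Fin 3))))) x j)) ∧ ((fun x => (⇑(u_top : MeasureTheory.Lp (EuclideanSpace ℝ (Fin 3)) 2 (MeasureTheory.volume (α := UnitAddTorus (Fin 3))))) (x + (Pi.single (0 : Fin 3) (((1/2 : ℝ)) : UnitAddCircle)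 + Pi.single (1 : Fin 3) (((1/2 : ℝ)) : UnitAddCircle)))) =ᵐ[MeasureTheory.volume] (⇑(u_top : MeasureTheory.Lp (EuclideanSpace ℝ (Fin 3)) 2 (MeasureTheory.volume (α := UnitAddTorus (Fin 3)))))) ∧ ((fun x => (⇑(u_top : MeasureTheory.Lp (EuclideanSpace ℝ (Fin 3)) 2 (MeasureTheory.volume (α := UnitAddTorus (Fin 3))))) (x + (Pi.single (0 : Fin 3) (((1/2 : ℝ)) : UnitAddCircle) + Pi.single (2 : Fin 3) (((1/2 : ℝ)) : UnitAddCircle)))) =ᵐ[MeasureTheory.volume] (⇑(u_top : MeasureTheory.Lp (EuclideanSpace ℝ (Fin 3)) 2 (MeasureTheory.volume (α := UnitAddTorus (Fin 3)))))) ∧ ((fun x => (⇑(u_top : MeasureTheory.Lp (EuclideanSpace ℝ (Fin 3)) 2 (MeasureTheory.volume (α := UnitAddTorus (Fin 3))))) ![(((1/2 : ℝ)) : UnitAddCircle) - x 1, x 0, x 2]) =ᵐ[MeasureTheory.volume] (fun x => !₂[-((⇑(u_top : MeasureTheory.Lp (EuclideanSpace ℝ (Fin 3)) 2 (MeasureTheory.volume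 (α := UnitAddTorus (Fin 3))))) x 1), (⇑(u_top : MeasureTheory.Lp (EuclideanSpace ℝ (Fin 3)) 2 (MeasureTheory.volume (α := UnitAddTorus (Fin 3))))) x 0, (⇑(u_top : MeasureTheory.Lp (EuclideanSpace ℝ (Fin 3)) 2 (MeasureTheory.volume (α := UnitAddTorus (Fin 3))))) x 2])))) → ∀ p ∈ connectedComponentIn {q : ℝ × ↥(Literature.Analysis.FunctionSpaces.Torus.energySpace (Fin 3)) | ν ≤ q.1 ∧ q.1 ≤ (1/5 : ℝ) ∧ ((q.2 : MeasureTheory.Lp (EuclideanSpace ℝ (Fin 3)) 2 (MeasureTheory.volume (α := UnitAddTorus (Fin 3)))) ∈ Literature.Analysis.FunctionSpaces.Torus.energySpaceV (Fin 3) ∧ Literature.Analysis.FluidPDE.Torus.IsSteadyWeakSolution q.1 f q.2 ∧ q.1 * (Literature.Analysis.FunctionSpaces.Torus.eGradNormSq (⇑(q.2 : MeasureTheory.Lp (EuclideanSpace ℝ (Fin 3)) 2 (MeasureTheory.volume (α := UnitAddTorus (Fin 3)))))).toReal = Literature.Analysis.FluidPDE.Torus.pairing (q.2 : MeasureTheory.Lp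 (EuclideanSpace ℝ (Fin 3)) 2 (MeasureTheory.volume (α := UnitAddTorus (Fin 3)))) f ∧ ((∀ i j : Fin 3, (fun x => (⇑(q.2 : MeasureTheory.Lp (EuclideanSpace ℝ (Fin 3)) 2 (MeasureTheory.volume (α := UnitAddTorus (Fin 3))))) (Function.update x i (-x i)) j) =ᵐ[MeasureTheory.volume] (fun x => if j = i then -((⇑(q.2 : MeasureTheory.Lp (EuclideanSpace ℝ (Fin 3)) 2 (MeasureTheory.volume (α := UnitAddTorus (Fin 3))))) x j) else (⇑(q.2 : MeasureTheory.Lp (EuclideanSpace ℝ (Fin 3)) 2 (MeasureTheory.volume (α := UnitAddTorus (Fin 3))))) x j)) ∧ ((fun x => (⇑(q.2 : MeasureTheory.Lp (EuclideanSpace ℝ (Fin 3)) 2 (MeasureTheory.volume (α := UnitAddTorus (Fin 3))))) (x + (Pi.single (0 : Fin 3) (((1/2 : ℝ)) : UnitAddCircle) + Pi.single (1 : Fin 3) (((1/2 : ℝ)) : UnitAddCircle)))) =ᵐ[MeasureTheory.volume] (⇑(q.2 : MeasureTheory.Lp (EuclideanSpace ℝ (Fin 3)) 2 (MeasureTheory.volume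 (α := UnitAddTorus (Fin 3)))))) ∧ ((fun x => (⇑(q.2 : MeasureTheory.Lp (EuclideanSpace ℝ (Fin 3)) 2 (MeasureTheory.volume (α := UnitAddTorus (Fin 3))))) (x + (Pi.single (0 : Fin 3) (((1/2 : ℝ)) : UnitAddCircle) + Pi.single (2 : Fin 3) (((1/2 : ℝ)) : UnitAddCircle)))) =ᵐ[MeasureTheory.volume] (⇑(q.2 : MeasureTheory.Lp (EuclideanSpace ℝ (Fin 3)) 2 (MeasureTheory.volume (α := UnitAddTorus (Fin 3)))))) ∧ ((fun x => (⇑(q.2 : MeasureTheory.Lp (EuclideanSpace ℝ (Fin 3)) 2 (MeasureTheory.volume (α := UnitAddTorus (Fin 3))))) ![(((1/2 : ℝ)) : UnitAddCircle) - x 1, x 0, x 2]) =ᵐ[MeasureTheory.volume] (fun x => !₂[-((⇑(q.2 : MeasureTheory.Lp (EuclideanSpace ℝ (Fin 3)) 2 (MeasureTheory.volume (α := UnitAddTorus (Fin 3))))) x 1), (⇑(q.2 : MeasureTheory.Lp (EuclideanSpace ℝ (Fin 3)) 2 (MeasureTheory.volume (α := UnitAddTorus (Fin 3))))) x 0, (⇑(q.2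 : MeasureTheory.Lp (EuclideanSpace ℝ (Fin 3)) 2 (MeasureTheory.volume (α := UnitAddTorus (Fin 3))))) x 2]))))} ((1/5 : ℝ), u_top), p.1 = ν → (1/200 : ℝ) ≤ Literature.Analysis.FluidPDE.Torus.pairing (p.2 : MeasureTheory.Lp (EuclideanSpace ℝ (Fin 3)) 2 (MeasureTheory.volume (α := UnitAddTorus (Fin 3)))) f := by
  intro f hf
  subst hf
  intro ν hν hν₁ u_top _ p hp hpν
  have hmem := connectedComponentIn_subset _ _ hp
  simp only [Set.mem_setOf_eq] at hmem
  obtain ⟨_, _, hV, hst, hen, hM, hS1, hS2, hQ⟩ := hmem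
  rw [hpν] at hst hen
  exact frontLoudHead hν hν₁ p.2 hV hst hen hM hS1 hS2 hQ

/-- The DegreeGate kernel's slim head `FrontSlimHeadTG` (`∀ ν ∈ [1/300, 1/100], ∀ u, IsGSteadyTG ν u → energyTG u < 2`)
in unfolded currency (`IsGSteadyTG` = V-membership ∧ steady weak solution ∧ energy equation ∧ Taylor–Green symmetry,
a.e.; `energyTG u = ∫|u|²`). [folklore] -/
theorem frontSlimHeadTG_holds :
    ∀ ν : ℝ, (1/300 : ℝ) ≤ ν → ν ≤ 1/100 →
      ∀ u : ↥(Literature.Analysis.FunctionSpaces.Torus.energySpace (Fin 3)), ((u : MeasureTheory.Lp (EuclideanSpace ℝ (Fin 3)) 2 (MeasureTheory.volume (α := UnitAddTorus (Fin 3)))) ∈ Literature.Analysis.FunctionSpaces.Torus.energySpaceV (Fin 3) ∧ Literature.Analysis.FluidPDE.Torus.IsSteadyWeakSolution ν tgForce u ∧ ν * (Literature.Analysis.FunctionSpaces.Torus.eGradNormSq (⇑(u : MeasureTheory.Lp (EuclideanSpace ℝ (Fin 3)) 2 (MeasureTheory.volume (α := UnitAddTorus (Fin 3)))))).toReal = Literature.Analysis.FluidPDE.Torus.pairing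 (u : MeasureTheory.Lp (EuclideanSpace ℝ (Fin 3)) 2 (MeasureTheory.volume (α := UnitAddTorus (Fin 3)))) tgForce ∧ ((∀ i j : Fin 3, (fun x => (⇑(u : MeasureTheory.Lp (EuclideanSpace ℝ (Fin 3)) 2 (MeasureTheory.volume (α := UnitAddTorus (Fin 3))))) (Function.update x i (-x i)) j) =ᵐ[MeasureTheory.volume] (fun x => if j = i then -((⇑(u : MeasureTheory.Lp (EuclideanSpace ℝ (Fin 3)) 2 (MeasureTheory.volume (α := UnitAddTorus (Fin 3))))) x j) else (⇑(u : MeasureTheory.Lp (EuclideanSpace ℝ (Fin 3)) 2 (MeasureTheory.volume (α := UnitAddTorus (Fin 3))))) x j)) ∧ ((fun x => (⇑(u : MeasureTheory.Lp (EuclideanSpace ℝ (Fin 3)) 2 (MeasureTheory.volume (α := UnitAddTorus (Fin 3))))) (x + (Pi.single (0 : Fin 3) (((1/2 : ℝ)) : UnitAddCircle) + Pi.single (1 : Fin 3) (((1/2 : ℝ)) : UnitAddCircle)))) =ᵐ[MeasureTheory.volume] (⇑(u : MeasureTheory.Lp (EuclideanSpace ℝ (Fin 3)) 2 (MeasureTheory.volume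 (α := UnitAddTorus (Fin 3)))))) ∧ ((fun x => (⇑(u : MeasureTheory.Lp (EuclideanSpace ℝ (Fin 3)) 2 (MeasureTheory.volume (α := UnitAddTorus (Fin 3))))) (x + (Pi.single (0 : Fin 3) (((1/2 : ℝ)) : UnitAddCircle) + Pi.single (2 : Fin 3) (((1/2 : ℝ)) : UnitAddCircle)))) =ᵐ[MeasureTheory.volume] (⇑(u : MeasureTheory.Lp (EuclideanSpace ℝ (Fin 3)) 2 (MeasureTheory.volume (α := UnitAddTorus (Fin 3)))))) ∧ ((fun x => (⇑(u : MeasureTheory.Lp (EuclideanSpace ℝ (Fin 3)) 2 (MeasureTheory.volume (α := UnitAddTorus (Fin 3))))) ![(((1/2 : ℝ)) : UnitAddCircle) - x 1, x 0, x 2]) =ᵐ[MeasureTheory.volume] (fun x => !₂[-((⇑(u : MeasureTheory.Lp (EuclideanSpace ℝ (Fin 3)) 2 (MeasureTheory.volume (α := UnitAddTorus (Fin 3))))) x 1), (⇑(u : MeasureTheory.Lp (EuclideanSpace ℝ (Fin 3)) 2 (MeasureTheory.volume (α := UnitAddTorus (Fin 3))))) x 0, (⇑(u : MeasureTheory.Lp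 (EuclideanSpace ℝ (Fin 3)) 2 (MeasureTheory.volume (α := UnitAddTorus (Fin 3))))) x 2])))) →
        (∫ x, ‖(u : MeasureTheory.Lp (EuclideanSpace ℝ (Fin 3)) 2 (MeasureTheory.volume (α := UnitAddTorus (Fin 3)))) x‖ ^ 2) < 2 :=
  fun _ hν _ u hG => frontSlimHead hν u hG.1 hG.2.2.1 hG.2.2.2.2.1 hG.2.2.2.2.2.1

/-- The DegreeGate kernel's loud head `FrontLoudHeadTG` (`∀ ν ∈ [1/2000, 1/100], ∀ u, IsGSteadyTG ν u → 1/200 ≤ powerTG u`)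
in unfolded currency (`powerTG u = (u, f_TG)`). [folklore] -/
theorem frontLoudHeadTG_holds :
    ∀ ν : ℝ, (1/2000 : ℝ) ≤ ν → ν ≤ 1/100 →
      ∀ u : ↥(Literature.Analysis.FunctionSpaces.Torus.energySpace (Fin 3)), ((u : MeasureTheory.Lp (EuclideanSpace ℝ (Fin 3)) 2 (MeasureTheory.volume (α := UnitAddTorus (Fin 3)))) ∈ Literature.Analysis.FunctionSpaces.Torus.energySpaceV (Fin 3) ∧ Literature.Analysis.FluidPDE.Torus.IsSteadyWeakSolution ν tgForce u ∧ ν * (Literature.Analysis.FunctionSpaces.Torus.eGradNormSq (⇑(u : MeasureTheory.Lp (EuclideanSpace ℝ (Fin 3)) 2 (MeasureTheory.volume (α := UnitAddTorus (Fin 3)))))).toReal = Literature.Analysis.FluidPDE.Torus.pairing (u : MeasureTheory.Lp (EuclideanSpace ℝ (Fin 3)) 2 (MeasureTheory.volume (α := UnitAddTorus (Fin 3)))) tgForce ∧ ((∀ i j : Fin 3, (fun x => (⇑(u : MeasureTheory.Lp (EuclideanSpace ℝ (Fin 3)) 2 (MeasureTheory.volume (α := UnitAddTorus (Fin 3)))))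 (Function.update x i (-x i)) j) =ᵐ[MeasureTheory.volume] (fun x => if j = i then -((⇑(u : MeasureTheory.Lp (EuclideanSpace ℝ (Fin 3)) 2 (MeasureTheory.volume (α := UnitAddTorus (Fin 3))))) x j) else (⇑(u : MeasureTheory.Lp (EuclideanSpace ℝ (Fin 3)) 2 (MeasureTheory.volume (α := UnitAddTorus (Fin 3))))) x j)) ∧ ((fun x => (⇑(u : MeasureTheory.Lp (EuclideanSpace ℝ (Fin 3)) 2 (MeasureTheory.volume (α := UnitAddTorus (Fin 3))))) (x + (Pi.single (0 : Fin 3) (((1/2 : ℝ)) : UnitAddCircle) + Pi.single (1 : Fin 3) (((1/2 : ℝ)) : UnitAddCircle)))) =ᵐ[MeasureTheory.volume] (⇑(u : MeasureTheory.Lp (EuclideanSpace ℝ (Fin 3)) 2 (MeasureTheory.volume (α := UnitAddTorus (Fin 3)))))) ∧ ((fun x => (⇑(u : MeasureTheory.Lp (EuclideanSpace ℝ (Fin 3)) 2 (MeasureTheory.volume (α := UnitAddTorus (Fin 3))))) (x + (Pi.single (0 : Fin 3) (((1/2 : ℝ)) : UnitAddCircle) + Pi.single (2 : Fin 3) (((1/2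 : ℝ)) : UnitAddCircle)))) =ᵐ[MeasureTheory.volume] (⇑(u : MeasureTheory.Lp (EuclideanSpace ℝ (Fin 3)) 2 (MeasureTheory.volume (α := UnitAddTorus (Fin 3)))))) ∧ ((fun x => (⇑(u : MeasureTheory.Lp (EuclideanSpace ℝ (Fin 3)) 2 (MeasureTheory.volume (α := UnitAddTorus (Fin 3))))) ![(((1/2 : ℝ)) : UnitAddCircle) - x 1, x 0, x 2]) =ᵐ[MeasureTheory.volume] (fun x => !₂[-((⇑(u : MeasureTheory.Lp (EuclideanSpace ℝ (Fin 3)) 2 (MeasureTheory.volume (α := UnitAddTorus (Fin 3))))) x 1), (⇑(u : MeasureTheory.Lp (EuclideanSpace ℝ (Fin 3)) 2 (MeasureTheory.volume (α := UnitAddTorus (Fin 3))))) x 0, (⇑(u : MeasureTheory.Lp (EuclideanSpace ℝ (Fin 3)) 2 (MeasureTheory.volume (α := UnitAddTorus (Fin 3))))) x 2])))) →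
        (1/200 : ℝ) ≤ Literature.Analysis.FluidPDE.Torus.pairing (u : MeasureTheory.Lp (EuclideanSpace ℝ (Fin 3)) 2 (MeasureTheory.volume (α := UnitAddTorus (Fin 3)))) tgForce :=
  fun _ hν hν₁ u hG => frontLoudHead hν hν₁ u hG.1 hG.2.1 hG.2.2.1 hG.2.2.2.1 hG.2.2.2.2.1 hG.2.2.2.2.2.1 hG.2.2.2.2.2.2

end Summit.AnomalousDissipation.AnomalousDissipation.Theorems.DegreeGate

end
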